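import Literature.AlgebraicTopology.KTheory.SphereCaps
import HarnessLib

/-!
# The round `2`-sphere for Bott periodicity: hemispheres, equator, complex coordinate; product pieces

Geometry for the clutching description of bundles over `X × S²` (Husemöller, *Fibre Bundles*,
Ch. 11 §2: `X × S² = X × D₀ ∪ X × D_∞`, `D₀ ∩ D_∞ = S¹`, `s(x) = (x, 1)`), with `S²` the round unit
sphere `S2r ⊆ ℝ³` (the model of the final statements) rather than the Riemann sphere:

* `Dup`, `Ddn` — the closed hemispheres `{x₂ ≥ 0}`, `{x₂ ≤ 0}` (caps of `SphereCaps.lean`): closed,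
  covering, compact, **contractible**; `Eqt = Dup ∩ Ddn = {x₂ = 0}` the equator; `zc : C(S², ℂ)`,
  `z = x₀ + i x₁`, with `|z| = 1` on the equator (`norm_zc_of_mem_Eqt`); base point `s2Base = (1,0,0)`
  with `z = 1`.
* Product pieces: for any `X` and `D ⊆ S` contractible compact, `sliceRetract d₀ : X × D → X × D`,
  `(x, d) ↦ (x, d₀)` is homotopic to the identity (`homotopic_id_sliceRetract`), hence every
  idempotent over `C(X × D, ℂ)` is algebraically equivalent to the pull-back of its slice
  (`equiv_map_sliceRetract`; Husemöller Ch. 11 Prop. 2.3, "`s π₀` is a homotopy equivalence").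

Everything is proved; no named facts.

## References

* D. Husemöller, *Fibre Bundles*, 3rd ed. (1994) [HusemollerFibreBundles1994]: Ch. 11 §2,
  Notations 2.1–2.2, Prop. 2.3.
-/

noncomputable section

open Set RealInnerProductSpace Metric unitInterval

namespace Literature.AlgebraicTopology.KTheory

open Literature.RingTheory.KTheory

universe u

/-! ### Idempotents over `X × D`-type pieces with `D` contractible come from `X` -/

section ProductPiece

variable {X : Type u} [TopologicalSpace X] {S : Type*} [TopologicalSpace S] {D : Set S}

/-- The retraction `(x, d) ↦ (x, d₀)` of the piece `X × D` onto the slice `X × {d₀}`. [folklore] -/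
def sliceRetract (d₀ : S) (hd₀ : d₀ ∈ D) : C(↥((univ : Set X) ×ˢ D), ↥((univ : Set X) ×ˢ D)) :=
  ⟨fun z ↦ ⟨(z.1.1, d₀), mem_univ _, hd₀⟩, by fun_prop⟩

/-- Auxiliary statement about the round sphere. [folklore] -/
@[simp] theorem sliceRetract_apply (d₀ : S) (hd₀ : d₀ ∈ D) (z : ↥((univ : Set X) ×ˢ D)) :
    (sliceRetract d₀ hd₀ z : X × S) = (z.1.1, d₀) := rfl

/-- On `X × D` with `D` contractible, the identity is homotopic to the retraction onto a slice.
[folklore] -/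
theorem homotopic_id_sliceRetract [ContractibleSpace D] (d₀ : S) (hd₀ : d₀ ∈ D) :
    (ContinuousMap.id ↥((univ : Set X) ×ˢ D)).Homotopic (sliceRetract d₀ hd₀) := by
  obtain ⟨c⟩ := homotopic_of_contractibleSpace (ContinuousMap.id D) (ContinuousMap.const D ⟨d₀, hd₀⟩)
  refine ⟨{ toFun := fun tz ↦ ⟨(tz.2.1.1, (c (tz.1, ⟨tz.2.1.2, tz.2.2.2⟩) : S)), mem_univ _, (c _).2⟩
            continuous_toFun := by fun_prop
            map_zero_left := fun z ↦ ?_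
            map_one_left := fun z ↦ ?_ }⟩
  · apply Subtype.ext
    change ((z.1.1, (c (0, ⟨z.1.2, z.2.2⟩) : S)) : X × S) = z.1
    rw [c.apply_zero]; rfl
  · apply Subtype.ext
    change ((z.1.1, (c (1, ⟨z.1.2, z.2.2⟩) : S)) : X × S) = (z.1.1, d₀)
    rw [c.apply_one]; rfl

/-- **Idempotents over `X × D`, `D` compact contractible, are pulled back from a slice**: for `P`
over `C(X × D, ℂ)` (the piece `univ ×ˢ D` of a product), `P ∼ r^* P` with `r (x, d) = (x, d₀)`;
equivalently `P ≅ π^* s^* P` (Husemöller, *Fibre Bundles*, Ch. 11 Prop. 2.3, proof: "`s π₀` is a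
homotopy equivalence"). [cite: HusemollerFibreBundles1994, Ch. 11 Prop. 2.3] -/
theorem equiv_map_sliceRetract [CompactSpace X] [CompactSpace D] [ContractibleSpace D] (d₀ : S) (hd₀ : d₀ ∈ D)
    (p : Idem C(↥((univ : Set X) ×ˢ D), ℂ)) : p ≈ p.map (comapRingHom (sliceRetract d₀ hd₀)) := by
  haveI : CompactSpace ↥((univ : Set X) ×ˢ D) := by
    have : IsCompact ((univ : Set X) ×ˢ D) := isCompact_univ.prod (isCompact_iff_compactSpace.2 ‹_›)
    exact isCompact_iff_compactSpace.1 this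
  have h := map_comapRingHom_equiv_of_homotopic (homotopic_id_sliceRetract (X := X) d₀ hd₀) p
  rwa [comapRingHom_id] at h

end ProductPiece

/-! ### The round sphere `S² ⊆ ℝ³` -/

/-- `ℝ³`. [folklore] -/
abbrev E3 : Type := EuclideanSpace ℝ (Fin 3)

/-- The round unit sphere `S² ⊆ ℝ³` (the model of `Metric.sphere` used in the final statements). [folklore] -/
abbrev S2r : Type := sphere (0 : E3) 1

/-- The north pole direction `(0, 0, 1)`. [folklore] -/
def ePole : E3 := EuclideanSpace.single 2 1

/-- Auxiliary statement about the round sphere. [folklore] -/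
theorem ePole_ne_zero : ePole ≠ 0 := by
  intro h
  have := congrArg (fun v : E3 ↦ v 2) h
  simp [ePole] at this

/-- Auxiliary statement about the round sphere. [folklore] -/
theorem inner_ePole (v : E3) : ⟪v, ePole⟫ = v 2 := by
  rw [ePole, EuclideanSpace.inner_single_right]; simp

/-- The closed upper hemisphere `D₊ = {x₂ ≥ 0}`. [folklore] -/
def Dup : Set S2r := cap ePole

/-- The closed lower hemisphere `D₋ = {x₂ ≤ 0}`. [folklore] -/
def Ddn : Set S2r := cap (-ePole)

/-- Auxiliary statement about the round sphere. [folklore] -/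
theorem mem_Dup_iff {x : S2r} : x ∈ Dup ↔ 0 ≤ (x : E3) 2 := by rw [Dup, mem_cap, inner_ePole]

/-- Auxiliary statement about the round sphere. [folklore] -/
theorem mem_Ddn_iff {x : S2r} : x ∈ Ddn ↔ (x : E3) 2 ≤ 0 := by
  rw [Ddn, mem_cap, inner_neg_right, inner_ePole]; constructor <;> intro h <;> linarith

/-- Auxiliary statement about the round sphere. [folklore] -/
theorem isClosed_Dup : IsClosed Dup := isClosed_cap _
/-- Auxiliary statement about the round sphere. [folklore] -/
theorem isClosed_Ddn : IsClosed Ddn := isClosed_cap _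
/-- Auxiliary statement about the round sphere. [folklore] -/
theorem Dup_union_Ddn : Dup ∪ Ddn = univ := cap_union_cap_neg _

/-- Auxiliary statement about the round sphere. -/
instance : ContractibleSpace Dup := contractibleSpace_cap ePole_ne_zero
/-- Auxiliary statement about the round sphere. -/
instance : ContractibleSpace Ddn := contractibleSpace_cap (neg_ne_zero.2 ePole_ne_zero)
/-- Auxiliary statement about the round sphere. -/
instance : CompactSpace Dup := isCompact_iff_compactSpace.1 isClosed_Dup.isCompact
/-- Auxiliary statement about the round sphere. -/
instance : CompactSpace Ddn := isCompact_iff_compactSpace.1 isClosed_Ddn.isCompact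

/-- The equator `S¹ = D₊ ∩ D₋ = {x₂ = 0}`. [folklore] -/
def Eqt : Set S2r := Dup ∩ Ddn

/-- Auxiliary statement about the round sphere. [folklore] -/
theorem mem_Eqt_iff {x : S2r} : x ∈ Eqt ↔ (x : E3) 2 = 0 := by
  rw [Eqt, mem_inter_iff, mem_Dup_iff, mem_Ddn_iff]; constructor
  · rintro ⟨h1, h2⟩; linarith
  · intro h; exact ⟨h.ge, h.le⟩

/-- **The complex coordinate** `z = x₀ + i x₁` on `S²` (of modulus `1` exactly on the equator).
[folklore] -/
def zc : C(S2r, ℂ) where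
  toFun x := ((x : E3) 0 : ℂ) + ((x : E3) 1 : ℂ) * Complex.I
  continuous_toFun := by fun_prop

/-- Auxiliary statement about the round sphere. [folklore] -/
theorem zc_apply (x : S2r) : zc x = ((x : E3) 0 : ℂ) + ((x : E3) 1 : ℂ) * Complex.I := rfl

/-- On the round sphere, `|z|² = 1 - x₂²`. [folklore] -/
theorem normSq_zc (x : S2r) : Complex.normSq (zc x) = 1 - (x : E3) 2 ^ 2 := by
  have hn : ‖(x : E3)‖ = 1 := by simp
  have h := EuclideanSpace.norm_sq_eq (x : E3)
  rw [hn, Fin.sum_univ_three] at h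
  rw [zc_apply, Complex.normSq_add_mul_I]
  simp only [Real.norm_eq_abs, sq_abs, one_pow] at h
  linarith

/-- On the equator the complex coordinate has modulus one. [folklore] -/
theorem norm_zc_of_mem_Eqt {x : S2r} (hx : x ∈ Eqt) : ‖zc x‖ = 1 := by
  rw [mem_Eqt_iff] at hx
  have h := normSq_zc x
  rw [hx, Complex.normSq_eq_norm_sq] at h
  have h2 : ‖zc x‖ ^ 2 = 1 := by rw [h]; ring
  exact (pow_eq_one_iff_of_nonneg (norm_nonneg _) two_ne_zero).1 h2

/-- The base point `(1, 0, 0)` of the equator (`z = 1`). [folklore] -/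
def s2Base : S2r := ⟨EuclideanSpace.single 0 1, by simp⟩

/-- Auxiliary statement about the round sphere. [folklore] -/
theorem s2Base_mem_Eqt : s2Base ∈ Eqt := by rw [mem_Eqt_iff]; simp [s2Base]
/-- Auxiliary statement about the round sphere. [folklore] -/
theorem s2Base_mem_Dup : s2Base ∈ Dup := s2Base_mem_Eqt.1
/-- Auxiliary statement about the round sphere. [folklore] -/
theorem s2Base_mem_Ddn : s2Base ∈ Ddn := s2Base_mem_Eqt.2
/-- Auxiliary statement about the round sphere. [folklore] -/
theorem zc_s2Base : zc s2Base = 1 := by rw [zc_apply]; simp [s2Base]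

end Literature.AlgebraicTopology.KTheory

end
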